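import Summits.HodgeConjecture.HodgeConjecture.Theorems.ThreefoldSquareWeightTwoDescent
import Summits.HodgeConjecture.HodgeConjecture.Theorems.Ring2AbelianAllStandardBKunnethProjectors
import Literature.AlgebraicGeometry.HodgeTheory.BettiKunnethPiecesHardLefschetzReduction
import Literature.AlgebraicGeometry.HodgeTheory.BettiKunnethPieceHodgeClassActions
import Literature.AlgebraicGeometry.HodgeTheory.KunnethComponentsDiagonalAction
import Literature.AlgebraicGeometry.HodgeTheory.KunnethComponentsOfHodgeClasses
import Literature.AlgebraicGeometry.HodgeTheory.HodgeRiemannPolarizabilityProofs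
import Literature.AlgebraicGeometry.HodgeTheory.HomologicalNumericalEquivalenceOfLefschetzStandard
import Literature.AlgebraicGeometry.HodgeTheory.ComplexConjugationHolds
import Literature.AlgebraicGeometry.HodgeTheory.LefschetzOneOneHolds
import Literature.AlgebraicGeometry.Motives.HodgeTensorFactsHolds
import HarnessLib

/-!
# The Künneth-projector converse `SQ3Conv` for ALL smooth projective threefolds: `B⋆(X) ∧ E₂(X) ∧ W₁₃(X) ⟹ HC22sq(X)`
# (cell `hodge-nonav`, sector SQ3, rows RED / SQ4 / SQ9–SQ10 / S19: the typed input `SQ3Conv` of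
# `Theorems/ThreefoldSquareWeightTwoDescent` is a THEOREM)

PROVENANCE. Cell hodge-nonav (HUMAN RULING D-0038), planner p1 g35 TARGET (v) (STATUS 2026-08-28T06:38:09Z / 06:41:11Z, after the
pointer of littype g19 06:40:28Z to the sub-cell Ring 2 AbelianAll files), prover seat `hodge-nonav-19716-p2` (g3). SUPPORT FILE
(`--supports stmt-HodgeConjecture-19654 --as helper`). `SQ3Conv` was typed (PRINT-IMPLIED by Kleiman's `B(X) ⟹ C(X)`, not proved) in
`Theorems/ThreefoldSquareWeightTwoDescent` §4 as the hypothesis `hconv` of the master reduction; it is discharged here.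

THE ARGUMENT. Let `c ∈ H⁴((X ⊗ X)(ℂ); ℂ)` be rational of Hodge type `(2,2)`. Write `c = Σ_{i+j=4} (t_{ij} ⊗ 1)` with `t_{ij}` Hodge
classes of the rational Künneth summands `Hⁱ(X;ℚ) ⊗ Hʲ(X;ℚ)` (`BettiUniverse.exists_eq_kunnethMap_of_mem_hodgeClasses`). The pieces
`(0,4)`, `(4,0)` are governed by `HC²(X)` (dimension `3`: `BettiUniverse.ofRatClass_crossMap_mem_algebraicClasses_of_fst_zero / _snd_zero`).
A middle piece `t = t_{ij}`, `(i,j) ∈ {(1,3),(2,2),(3,1)}`, acts on `H^{6−j}(X(ℂ); ℂ)` ONLY, as a rational Hodge shift of bidegree `(−1,−1)`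
(`BettiUniverse.typeShift_corrAction_crossMap_of_mem_hodgeClasses`); `E₂(X)` / `W₁₃(X)` say this action is that of SOME algebraic class
`γ`, which may however act non-trivially ("junk") in the other degrees. KILL THE JUNK WITH ONE KÜNNETH PROJECTOR: under `B⋆(X)` the tree
has, for every `k`, ONE algebraic class `π_k` acting as `id` on `Hᵏ` and as `0` on every other degree
(`Ring2.AbelianAll.exists_kunnethProjector_of_standardConjectureBStar`, Kleiman's induction, kernel) and ONE-class composition of
correspondences in every degree (`Ring2.AbelianAll.exists_corrComp`); so `Γ := γ ∘ π_{6−j}` is algebraic and acts as `γ` on `H^{6−j}` and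
as `0` elsewhere (`exists_algebraic_corrAction_eq_ite`), i.e. EXACTLY as `t ⊗ 1` in every degree — hence `Γ = t ⊗ 1` (a class on `X × X` is
determined by its correspondence action in all degrees, `eq_of_forall_corrAction_eq`) and `t ⊗ 1` is algebraic
(`ofRatClass_crossMap_mem_algebraicClasses_of_isAlgebraicCorrespondence`). Only the SOURCE-side projector is needed.

CONTENT (sorry-free over tree theorems; no definition, no named fact, no new axiom): §1 the junk-killing lemma (any dimension `n`);
§2 a Künneth summand whose action is an algebraic correspondence is algebraic (any `n`, any slot); §3 **`sq3Conv : SQ3Conv`** (verbatim the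
body typed in `Theorems/ThreefoldSquareWeightTwoDescent`); §4 the master reduction and its corollaries with `hconv` DISCHARGED:
`HC22sq(X) ⟸ B⋆(X) ∧ E(S) ∧ W1Retr[X] ∧ HC22C[X]` etc.

HONEST SCOPE. Structure theorem: the rational `(2,2)`-classes of `X × X` for an ARBITRARY smooth projective threefold are decided by
`B⋆(X)`, the weight-two corner `E₂(X)` and the odd slots `W₁₃(X)`; no case of the Hodge conjecture for a new variety is proved here
(`B⋆(X)` for threefolds of general type, `E(S)` for `p_g(S) > 0`, are open); rung F-H1 not moved.

## References

* [Kleiman1968AlgebraicCycles] S. Kleiman, Algebraic cycles and the Weil conjectures (1968), §1.4, §2 Prop. 2.3, Thm. 2A11.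
* [Andre1996Motifs] Y. André, Pour une théorie inconditionnelle des motifs (1996), §0.2, §2.1, Appendix (B ⇒ G).
* [VoisinHodgeI2002] C. Voisin, Hodge Theory and Complex Algebraic Geometry I (2002), §11.3.3 Thm. 11.38–11.41, p. 286.
* [Voisin2025] C. Voisin, Cycle classes on algebraic varieties (2025), §3.2.1 (12)–(14).
* [Fulton1998] W. Fulton, Intersection Theory (1998), §16.1 Def. 16.1.1, Prop. 16.1.1.
-/

set_option linter.dupNamespace false

noncomputable section

open CategoryTheory AlgebraicGeometry MonoidalCategory CartesianMonoidalCategory Finset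
open scoped TensorProduct
open Literature.AlgebraicTopology.SingularHomology
open Literature.AlgebraicGeometry Literature.AlgebraicGeometry.Motives Literature.AlgebraicGeometry.HodgeTheory
open Literature.Barriers.HodgeConjecture
open Literature.AlgebraicGeometry.Tankeev2011
open Summit.HodgeConjecture.HodgeConjecture.Theorems
open Summit.HodgeConjecture.HodgeConjecture.Ring2.AbelianAll

namespace Summit.HodgeConjecture.HodgeConjecture.Theorems.ThreefoldSquare

/-- `RHShift[m, n, Y, X, a, b, e, φ]` (as in `Theorems/ThreefoldSquareKunnethShifts`). Local notation only. -/
local notation3 (prettyPrint := false) "RHShift[" m ", " n ", " Y ", " X ", " a ", " b ", " e ", " φ "]" =>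
  ((∀ c, IsRationalClass c → IsRationalClass (φ c)) ∧
  (∀ (p q : ℕ), p + q = a → ∀ c, IsOfHodgeType n X a p q c →
      ∀ (p' q' : ℕ), p' + n = p + e → q' + n = q + e → IsOfHodgeType m Y b p' q' (φ c)) ∧
  (∀ (p q : ℕ), p + q = a → ∀ c, IsOfHodgeType n X a p q c → (p + e < n ∨ q + e < n) → φ c = 0))

/-- `E2[X]` (as in `Theorems/ThreefoldSquareWeightTwoDescent`). Local notation only. -/
local notation3 (prettyPrint := false) "E2[" X "]" =>
  (∀ φ : complexBetti X (2 * 2) →ₗ[ℂ] complexBetti X (2 * 1),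
    RHShift[3, 3, X, X, 2 * 2, 2 * 1, 2, φ] → IsAlgebraicCorrespondence 3 3 X X φ)

/-- `ES[S]` (as in `Theorems/ThreefoldSquareWeightTwoDescent`). Local notation only. -/
local notation3 (prettyPrint := false) "ES[" S "]" =>
  (∀ ψ : complexBetti S (2 * 1) →ₗ[ℂ] complexBetti S (2 * 1),
    RHShift[2, 2, S, S, 2 * 1, 2 * 1, 2, ψ] → IsAlgebraicCorrespondence 2 2 S S ψ)

/-- `OddShifts[X]` (as in `Theorems/ThreefoldSquareKunnethShifts`). Local notation only. -/
local notation3 (prettyPrint := false) "OddShifts[" X "]" =>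
  ((∀ φ : complexBetti X 5 →ₗ[ℂ] complexBetti X 3,
    RHShift[3, 3, X, X, 5, 3, 2, φ] → IsAlgebraicCorrespondence 3 3 X X φ) ∧
  (∀ φ : complexBetti X 3 →ₗ[ℂ] complexBetti X 1,
    RHShift[3, 3, X, X, 3, 1, 2, φ] → IsAlgebraicCorrespondence 3 3 X X φ))

/-- `W1Retr[X]` (as in `Theorems/ThreefoldSquareKunnethShifts`). Local notation only. -/
local notation3 (prettyPrint := false) "W1Retr[" X "]" =>
  (∃ (C : SchemeOver ℂ) (_ : IsSmoothProjective 1 C)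
    (u : complexBetti X 5 →ₗ[ℂ] complexBetti C 1) (v : complexBetti C 1 →ₗ[ℂ] complexBetti X 5)
    (u' : complexBetti X 1 →ₗ[ℂ] complexBetti C 1) (v' : complexBetti C 1 →ₗ[ℂ] complexBetti X 1),
    IsAlgebraicCorrespondence 1 3 C X u ∧ RHShift[3, 1, X, C, 1, 5, 3, v] ∧ v ∘ₗ u = LinearMap.id ∧
    IsAlgebraicCorrespondence 3 1 X C v' ∧ RHShift[1, 3, C, X, 1, 1, 3, u'] ∧ v' ∘ₗ u' = LinearMap.id)

/-- `HC22C[X]` (as in `Theorems/ThreefoldSquareKunnethShifts`; body of `ThreefoldTimesCurve.HC22TimesCurve X`). Local notation only. -/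
local notation3 (prettyPrint := false) "HC22C[" X "]" =>
  (∀ ⦃C : SchemeOver ℂ⦄, IsSmoothProjective 1 C →
    (∀ c : complexBetti (X ⊗ C) (2 * 2), IsRationalClass c →
        IsOfHodgeType (3 + 1) (X ⊗ C) (2 * 2) 2 2 c → c ∈ algebraicClasses (X ⊗ C) 2) ∧
      (∀ c : complexBetti (C ⊗ X) (2 * 2), IsRationalClass c →
        IsOfHodgeType (1 + 3) (C ⊗ X) (2 * 2) 2 2 c → c ∈ algebraicClasses (C ⊗ X) 2))

/-- `HC22sq[X]` (as in `Theorems/ThreefoldSquareWeightTwoDescent`; body of `LefschetzStandardShadows.HodgeCodimTwoSquaresOfThreefolds`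
at `X`). Local notation only. -/
local notation3 (prettyPrint := false) "HC22sq[" X "]" =>
  (∀ c : complexBetti (X ⊗ X) (2 * 2), IsRationalClass c →
    IsOfHodgeType (3 + 3) (X ⊗ X) (2 * 2) 2 2 c → c ∈ algebraicClasses (X ⊗ X) 2)

/-- `SQ3Conv` (verbatim as typed in `Theorems/ThreefoldSquareWeightTwoDescent`). Local notation only. -/
local notation3 (prettyPrint := false) "SQ3Conv" =>
  (∀ ⦃X : SchemeOver ℂ⦄, IsSmoothProjective 3 X →
    (∀ η : complexBetti X 2, StandardConjectureBStar 3 X η) → E2[X] → OddShifts[X] → HC22sq[X])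

/-- `SecCl[hS, hX, i]` (as in `Theorems/ThreefoldSquareWeightTwoDescent`). Local notation only. -/
local notation3 (prettyPrint := false) "SecCl[" hS ", " hX ", " i "]" =>
  complexGysin complexOrientationFamily hS hX i (rfl : 0 + 2 * 3 = 2 + 2 * 2)
    (singularCohomology.one ℂ (ComplexPoints _))

variable {n : ℕ} {X S : SchemeOver ℂ}

/-! ## §1 Killing the junk of an algebraic correspondence with ONE Künneth projector -/

/-- **Under `B⋆(X, η)`, for every algebraic class `γ ∈ Nᵉ H^{2e}((X ⊗ X)(ℂ); ℂ)` and every degree `k` there is ONE algebraic class `Γ`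
of the same codimension acting as `[γ]_*` on `Hᵏ(X(ℂ); ℂ)` and as `0` on every other degree** — `Γ = γ ∘ π_k` with the algebraic
Künneth projector `π_k` of the tree (`exists_kunnethProjector_of_standardConjectureBStar`: `id` on `Hᵏ`, `0` elsewhere) and the
one-class composition `exists_corrComp`. [cite: Kleiman1968AlgebraicCycles, §2 Prop. 2.3 and Cor. 2.5]
[cite: Fulton1998, §16.1 Def. 16.1.1 and Prop. 16.1.1] -/
theorem exists_algebraic_corrAction_eq_ite (hX : IsSmoothProjective n X) {η : complexBetti X 2}
    (hη : IsPolarizationClass n X η) (hB : StandardConjectureBStar n X η) {e : ℕ}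
    {γ : complexBetti (X ⊗ X) (2 * e)} (hγ : γ ∈ algebraicClasses (X ⊗ X) e) (k : ℕ) :
    ∃ Γ ∈ algebraicClasses (X ⊗ X) e, ∀ (a b : ℕ) (hab : a + 2 * e = b + 2 * n),
      corrAction complexOrientationFamily hX hX hab Γ =
        if a = k then corrAction complexOrientationFamily hX hX hab γ else 0 := by
  obtain ⟨π, hπ, Hπ⟩ := exists_kunnethProjector_of_standardConjectureBStar hX hη hB k
  obtain ⟨Γ, hΓ, HΓ⟩ := exists_corrComp complexOrientationFamily hX hX hX (e := e) (e' := n) (e'' := e) rfl hγ hπ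
  refine ⟨Γ, hΓ, fun a b hab ↦ ?_⟩
  rw [HΓ (a₁ := a) rfl hab hab, Hπ a]
  split_ifs
  · rw [one_smul, LinearMap.comp_id]
  · rw [zero_smul, LinearMap.comp_zero]

/-! ## §2 A Künneth summand whose action is an algebraic correspondence is algebraic -/

/-- **Under `B⋆(X, η)`: if the action `Hᵃ(X(ℂ); ℂ) → Hⁱ(X(ℂ); ℂ)` (`a + j = 2n`) of a class `t` of the rational Künneth summand
`Hⁱ(X;ℚ) ⊗ Hʲ(X;ℚ)` is induced by SOME algebraic class, then `t ⊗ 1` itself is algebraic.** The witness `γ` of the hypothesis may act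
non-trivially in other degrees; `Γ = γ ∘ π_a` (§1) acts as `γ`, i.e. as `t ⊗ 1`, on `Hᵃ` and as `0 = (t ⊗ 1)_*` elsewhere
(`corrAction_eq_zero_of_mem_kunnethPiece_of_ne`), so `Γ = t ⊗ 1` (`eq_of_forall_corrAction_eq`).
[cite: VoisinHodgeI2002, §11.3.3 Lemma 11.41 and p. 286] [cite: Voisin2025, §3.2.1 (12)–(13)] [cite: Kleiman1968AlgebraicCycles, §2 Prop. 2.3] -/
theorem ofRatClass_crossMap_mem_algebraicClasses_of_isAlgebraicCorrespondence (hX : IsSmoothProjective n X)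
    {η : complexBetti X 2} (hη : IsPolarizationClass n X η) (hB : StandardConjectureBStar n X η) {c i j a : ℕ}
    (hij : i + j = 2 * c) (haj : a + j = 2 * n) (hab : a + 2 * c = i + 2 * n)
    {t : bettiCohomology X i ⊗[ℚ] bettiCohomology X j}
    (hA : IsAlgebraicCorrespondence n n X X (corrAction complexOrientationFamily hX hX hab
      (ofRatClass (ComplexPoints (X ⊗ X)) (2 * c) (BettiUniverse.crossMap X X hij t)))) :
    ofRatClass (ComplexPoints (X ⊗ X)) (2 * c) (BettiUniverse.crossMap X X hij t) ∈ algebraicClasses (X ⊗ X) c := by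
  obtain ⟨e, hab', γ, hγ, hφ⟩ := IsAlgebraicCorrespondence.exists_eq_corrAction hX hX hA
  obtain rfl : c = e := by omega
  obtain ⟨Γ, hΓ, HΓ⟩ := exists_algebraic_corrAction_eq_ite hX hη hB hγ a
  suffices hCΓ : ofRatClass (ComplexPoints (X ⊗ X)) (2 * c) (BettiUniverse.crossMap X X hij t) = Γ by
    rw [hCΓ]; exact hΓ
  refine eq_of_forall_corrAction_eq complexOrientationFamily hX hX fun a' b' hab'' ↦ ?_
  rw [HΓ a' b' hab'']
  by_cases ha : a' = a
  · subst ha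
    obtain rfl : b' = i := by omega
    rw [if_pos rfl]
    exact hφ
  · rw [if_neg ha]
    exact corrAction_eq_zero_of_mem_kunnethPiece_of_ne complexOrientationFamily hX hX hij
      (ofRatClass_crossMap_mem_kunnethPiece hij t) hab'' (by omega)

/-! ## §3 `SQ3Conv` -/

/-- **THE KÜNNETH-PROJECTOR CONVERSE (KERNEL): for every smooth projective threefold `X`, `B⋆(X)` (at every class), `E₂(X)` and
`W₁₃(X)` imply that the rational `(2,2)`-classes of `X × X` are algebraic** — the typed input `SQ3Conv` of
`Theorems/ThreefoldSquareWeightTwoDescent` §4. Decompose a rational `(2,2)`-class into Hodge classes of the rational Künneth summands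
(`BettiUniverse.exists_eq_kunnethMap_of_mem_hodgeClasses`); `(0,4)`, `(4,0)` by `HC²(X)` (dimension `3`); `(1,3)`, `(2,2)`, `(3,1)` act as
rational Hodge shifts of bidegree `(−1,−1)` on `H³`, `H⁴`, `H⁵` (`BettiUniverse.typeShift_corrAction_crossMap_of_mem_hodgeClasses`), are
algebraic correspondences by `W₁₃(X)` / `E₂(X)` / `W₁₃(X)`, hence algebraic classes by §2. (statement: cell hodge-nonav ROUTE-P1T/P1U typed
row `SQ3Converse`; PRINT-IMPLIED by Kleiman's `B ⇒ C`, here a theorem over the tree's per-degree `B⋆`)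
[cite: Kleiman1968AlgebraicCycles, §2 Prop. 2.3 and Thm. 2A11] [cite: VoisinHodgeI2002, §11.3.3 Thm. 11.38 and Lemma 11.41] -/
theorem sq3Conv : SQ3Conv := by
  intro X hX hB hE2 hOdd c hc hH
  classical
  haveI : HodgeTensorFacts.{0, 0} := hodgeTensorFacts_holds
  have hHD : exists_isReal_hodgeModel := exists_isReal_hodgeModel_holds
  have hI : hodgePQ_independent_of_hodgeModel := hodgePQ_independent_of_hodgeModel_holds
  have hXX : IsSmoothProjective (3 + 3) (X ⊗ X) := hX.tensor_holds hX
  obtain ⟨D⟩ := nonempty_kaehlerRationalDatum hX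
  have hη : IsPolarizationClass 3 X D.Hη := D.isPolarizationClass_Hη hX
  have hBη : StandardConjectureBStar 3 X D.Hη := hB _
  -- `HC²(X)`: dimension `3`
  have hHC : ∀ z ∈ (BettiUniverse.hodge hHD hX (2 * 2)).hodgeClasses 2,
      ofRatClass (ComplexPoints X) (2 * 2) z ∈ algebraicClasses X 2 := fun z hz ↦
    (hodgeConjectureFor_of_dim_le_three_holds le_rfl hX).2 2 _ (isRationalClass_ofRatClass z)
      ((BettiUniverse.mem_hodgeClasses_hodge_iff_isOfHodgeType hHD hX 2 z).1 hz)
  -- the rational Künneth decomposition of `c`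
  obtain ⟨v, rfl⟩ := (isRationalClass_iff_mem_range_ofRatClass c).1 hc
  have hv : v ∈ (BettiUniverse.hodge hHD hXX (2 * 2)).hodgeClasses 2 :=
    (BettiUniverse.mem_hodgeClasses_hodge_iff_isOfHodgeType hHD hXX 2 v).2 hH
  obtain ⟨t, ⟨ht, hsum⟩, -⟩ :=
    BettiUniverse.exists_eq_kunnethMap_of_mem_hodgeClasses hHD hI hX hX hXX (2 * 2) ((2 : ℕ) : ℤ) hv
  rw [hsum, map_sum]
  refine Submodule.sum_mem _ fun ij _ ↦ ?_
  obtain ⟨⟨i, j⟩, hij⟩ := ij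
  have hij' : i + j = 2 * 2 := mem_antidiagonal.1 hij
  have htij := ht ⟨(i, j), hij⟩
  change ofRatClass (ComplexPoints (X ⊗ X)) (2 * 2) (BettiUniverse.crossMap X X hij' (t ⟨(i, j), hij⟩)) ∈
    algebraicClasses (X ⊗ X) 2
  have hj4 : j ≤ 4 := by omega
  interval_cases j
  · -- `(4,0)`: `HC²(X)` on the first factor
    exact BettiUniverse.ofRatClass_crossMap_mem_algebraicClasses_of_snd_zero hHD hX hX hij' hHC htij
  · -- `(3,1)`: the action `H⁵ → H³` is algebraic by `W₁₃(X)`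
    obtain rfl : i = 3 := by omega
    have T := BettiUniverse.typeShift_corrAction_crossMap_of_mem_hodgeClasses hHD hX hX hij'
      (show 5 + 2 * 2 = 3 + 2 * 3 by norm_num) htij
    exact ofRatClass_crossMap_mem_algebraicClasses_of_isAlgebraicCorrespondence hX hη hBη hij' (a := 5) (by norm_num)
      (by norm_num) (hOdd.1 _ ⟨fun u hu ↦ T.1 u hu, fun p q _ u hu p' q' hp hq ↦ T.2.1 p q u hu p' q' hp hq,
        fun p q _ u hu h ↦ T.2.2 p q u hu h⟩)
  · -- `(2,2)`: the action `H⁴ → H²` is algebraic by `E₂(X)`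
    obtain rfl : i = 2 := by omega
    have T := BettiUniverse.typeShift_corrAction_crossMap_of_mem_hodgeClasses hHD hX hX hij'
      (show 2 * 2 + 2 * 2 = 2 + 2 * 3 by norm_num) htij
    have hA : IsAlgebraicCorrespondence 3 3 X X (corrAction complexOrientationFamily hX hX
        (show 2 * 2 + 2 * 2 = 2 * 1 + 2 * 3 by norm_num)
        (ofRatClass (ComplexPoints (X ⊗ X)) (2 * 2) (BettiUniverse.crossMap X X hij' (t ⟨(2, 2), hij⟩)))) :=
      hE2 _ ⟨fun u hu ↦ T.1 u hu, fun p q _ u hu p' q' hp hq ↦ T.2.1 p q u hu p' q' hp hq,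
        fun p q _ u hu h ↦ T.2.2 p q u hu h⟩
    exact ofRatClass_crossMap_mem_algebraicClasses_of_isAlgebraicCorrespondence hX hη hBη hij' (a := 2 * 2)
      (by norm_num) (by norm_num) hA
  · -- `(1,3)`: the action `H³ → H¹` is algebraic by `W₁₃(X)`
    obtain rfl : i = 1 := by omega
    have T := BettiUniverse.typeShift_corrAction_crossMap_of_mem_hodgeClasses hHD hX hX hij'
      (show 3 + 2 * 2 = 1 + 2 * 3 by norm_num) htij
    exact ofRatClass_crossMap_mem_algebraicClasses_of_isAlgebraicCorrespondence hX hη hBη hij' (a := 3) (by norm_num)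
      (by norm_num) (hOdd.2 _ ⟨fun u hu ↦ T.1 u hu, fun p q _ u hu p' q' hp hq ↦ T.2.1 p q u hu p' q' hp hq,
        fun p q _ u hu h ↦ T.2.2 p q u hu h⟩)
  · -- `(0,4)`: `HC²(X)` on the second factor
    obtain rfl : i = 0 := by omega
    exact BettiUniverse.ofRatClass_crossMap_mem_algebraicClasses_of_fst_zero hHD hX hX hij' hHC htij

/-! ## §4 The master reduction with `SQ3Conv` discharged -/

/-- **`HC22sq(X) ⟸ B⋆(X) ∧ E(S) ∧ W1Retr[X] ∧ HC22C[X]`** for any surface `i : S ⟶ X` with `i_* 1_S` a polarisation class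
(`hodgeTwoTwo_sq_of_B_surface_curves` with `hconv := sq3Conv`). [cite: Kleiman1968AlgebraicCycles, §2 Thm. 2A11]
[cite: VoisinHodgeI2002, §11.3.3 Lemma 11.41] -/
theorem hodgeTwoTwo_sq_of_B_surface_curves' (hX : IsSmoothProjective 3 X)
    (hS : IsSmoothProjective 2 S) (i : S ⟶ X) (hσ : IsPolarizationClass 3 X (SecCl[hS, hX, i]))
    (hB : ∀ η : complexBetti X 2, StandardConjectureBStar 3 X η) (hE : ES[S])
    (hR : W1Retr[X]) (h : HC22C[X]) : HC22sq[X] :=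
  hodgeTwoTwo_sq_of_B_surface_curves sq3Conv hX hS i hσ hB hE hR h

/-- **`HC22sq(X) ⟸ B⋆(X) ∧ HC⁴(S × S)_{(2,2)} ∧ W1Retr[X] ∧ HC22C[X]`** (`hodgeTwoTwo_sq_of_B_fourfolds` with `hconv := sq3Conv`): the
rational `(2,2)`-classes of the SIXFOLD `X × X` are decided by `B(X)` and Hodge `(2,2)`-classes on the FOURFOLDS `S × S`, `X × C`, `C × X`.
[cite: Kleiman1968AlgebraicCycles, §2 Thm. 2A11] [cite: VoisinHodgeI2002, §11.3.3 Lemma 11.41] -/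
theorem hodgeTwoTwo_sq_of_B_fourfolds' (hX : IsSmoothProjective 3 X)
    (hS : IsSmoothProjective 2 S) (i : S ⟶ X) (hσ : IsPolarizationClass 3 X (SecCl[hS, hX, i]))
    (hB : ∀ η : complexBetti X 2, StandardConjectureBStar 3 X η)
    (hSS : ∀ c : complexBetti (S ⊗ S) (2 * 2), IsRationalClass c →
      IsOfHodgeType (2 + 2) (S ⊗ S) (2 * 2) 2 2 c → c ∈ algebraicClasses (S ⊗ S) 2)
    (hR : W1Retr[X]) (h : HC22C[X]) : HC22sq[X] :=
  hodgeTwoTwo_sq_of_B_fourfolds sq3Conv hX hS i hσ hB hSS hR h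

/-- **Uniruled-type corollary without `SQ3Conv`**: `HC22sq(X) ⟸ B⋆(X) ∧ E(S) ∧ W1Retr[X] ∧ [CH₀(X × C), CH₀(C × X) supported in
dimension ≤ 3 for all curves C]`. [cite: BlochSrinivas1983, Thm. 1 (3)] [cite: Kleiman1968AlgebraicCycles, §2 Thm. 2A11] -/
theorem hodgeTwoTwo_sq_of_B_surface_chowZero' (hX : IsSmoothProjective 3 X)
    (hS : IsSmoothProjective 2 S) (i : S ⟶ X) (hσ : IsPolarizationClass 3 X (SecCl[hS, hX, i]))
    (hB : ∀ η : complexBetti X 2, StandardConjectureBStar 3 X η) (hE : ES[S]) (hR : W1Retr[X])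
    (hW : ∀ ⦃C : SchemeOver ℂ⦄, IsSmoothProjective 1 C →
      HasChowZeroSupportedInDimLE (X ⊗ C) 3 ∧ HasChowZeroSupportedInDimLE (C ⊗ X) 3) : HC22sq[X] :=
  hodgeTwoTwo_sq_of_B_surface_chowZero sq3Conv hX hS i hσ hB hE hR hW

/-- The same with Tankeev's named fact discharging `B⋆(X)` off general type (`κ(X) < 3`); CONDITIONAL on that fact only beyond the displayed
geometric inputs. [cite: Tankeev2011, main theorem] [cite: Kleiman1968AlgebraicCycles, §2 Thm. 2A11] -/
theorem hodgeTwoTwo_sq_of_tankeev_surface_chowZero'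
    (hT : Tankeev2011_lefschetzStandard_threefold_kodairaDim_lt_three) (hX : IsSmoothProjective 3 X)
    (hκ : ¬ Motives.IsOfGeneralType 3 X) (hS : IsSmoothProjective 2 S) (i : S ⟶ X)
    (hσ : IsPolarizationClass 3 X (SecCl[hS, hX, i])) (hE : ES[S]) (hR : W1Retr[X])
    (hW : ∀ ⦃C : SchemeOver ℂ⦄, IsSmoothProjective 1 C →
      HasChowZeroSupportedInDimLE (X ⊗ C) 3 ∧ HasChowZeroSupportedInDimLE (C ⊗ X) 3) : HC22sq[X] :=
  hodgeTwoTwo_sq_of_tankeev_surface_chowZero sq3Conv hT hX hκ hS i hσ hE hR hW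

end Summit.HodgeConjecture.HodgeConjecture.Theorems.ThreefoldSquare

end
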